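import Literature.AlgebraicGeometry.Modules.DeligneSheafHomGlobal
import Literature.AlgebraicGeometry.Morphisms.CechModuleH2
import Literature.AlgebraicGeometry.Morphisms.FormalFunctionsModule
import Literature.AlgebraicGeometry.Modules.SectionsExact
import HarnessLib

/-!
# Every Čech cocycle of a quasi-coherent module lies in a coherent submodule (Noetherian separated schemes)

EGA I (1971) 6.9.9 / Hartshorne II Ex. 5.15 (e): on a Noetherian scheme every quasi-coherent module is
the union of its coherent submodules. This file proves the finite form needed to pass Čech-cohomology
vanishing from coherent to quasi-coherent (affine-localizing, `Modules/AffineLocalizing`) modules, via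
the global Deligne homomorphism of `Modules/DeligneSheafHomGlobal` (so torsion in `M` is allowed):

* `coh_image_of_isAffineLocalizing` — the image of a coherent module in an affine-localizing one is
  coherent;
* **`exists_coh_mono_app_eq`** — finitely many sections `s_k ∈ Γ(W_k, M)` of an affine-localizing `M`
  on a Noetherian separated `X` lie in ONE coherent submodule `M′ ↪ M` (induction: the image of
  `M′ ⊞ 𝓘ⁿ𝒪_X ⟶ M`);
* **`exists_coh_cechMZ2_map_eq`** — for a finite family of (affine) opens `𝒰` and a Čech `2`-cocycle
  `z` of `M` there are a coherent `M′`, `φ : M′ ⟶ M` and a `2`-cocycle `z′` of `M′` with `φ(z′) = z`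
  (the cocycle condition transfers because `φ` is injective on sections). This is step S8 of route (δ)
  of the cell res-hironaka (F-53): with `Ȟ² = 0` for coherent modules it gives `Ȟ² = 0` for
  affine-localizing ones.

Everything is proved; no named facts.

## References

* R. Hartshorne, *Algebraic Geometry*, GTM 52 (1977): II Prop. 5.7, II Ex. 5.15 (e) (p. 126).
  [Hartshorne1977]
* A. Grothendieck, J. Dieudonné, EGA I (Springer 1971), 6.9.9, 6.9.17.
-/

noncomputable section

-- `TopCat.Presheaf`/`Scheme.Modules` are not reducible (as in Mathlib's `AlgebraicGeometry/Modules`).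
set_option backward.isDefEq.respectTransparency false

open CategoryTheory AlgebraicGeometry Limits TopologicalSpace Opposite

universe u v

namespace Literature.AlgebraicGeometry.Morphisms

open Literature.AlgebraicGeometry.Modules

variable {X : Scheme.{u}}

/-- The image of a morphism from a coherent module to an affine-localizing module is coherent
(`X` locally Noetherian). [cite: Hartshorne1977, II Prop. 5.7 (p. 114)] -/
theorem coh_image_of_isAffineLocalizing [IsLocallyNoetherian X] {P M : X.Modules} (g : P ⟶ M)
    (hP : Coh P) (hM : IsAffineLocalizing M) : Coh (Abelian.image g) :=
  Coh.of_shortExact₃ (shortExact_kernel_factorThruImage g)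
    ⟨IsAffineLocalizing.kernel g hP.loc hM, hP.ft.kernel g⟩ hP

/-- A binary biproduct of coherent modules is coherent. [cite: Hartshorne1977, II Prop. 5.7 (p. 114)] -/
private theorem coh_biprod_of_coh {P Q : X.Modules} (hP : Coh P) (hQ : Coh Q) : Coh (P ⊞ Q) := by
  have hS := (ShortComplex.Splitting.ofHasBinaryBiproduct P Q).shortExact
  exact ⟨IsAffineLocalizing.of_shortExact₂ hS hP.loc hQ.loc,
    IsAffineFiniteType.of_shortExact₂ hS hP.loc hP.ft hQ.ft⟩

/-- `(φ ≫ ψ).app U x = ψ.app U (φ.app U x)`. [folklore] -/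
private theorem comp_app_apply_aux {P Q R : X.Modules} (φ : P ⟶ Q) (ψ : Q ⟶ R) (U : X.Opens) (x : Γ(P, U)) :
    (φ ≫ ψ).app U x = ψ.app U (φ.app U x) := rfl

/-- **Finitely many sections of an affine-localizing module lie in a coherent submodule** (`X`
Noetherian separated): for sections `s_k ∈ Γ(W_k, M)`, `k` in a finite type, there is a coherent
`M′` with a monomorphism `ι : M′ ⟶ M` and sections `y_k ∈ Γ(W_k, M′)` with `ι(y_k) = s_k`
(EGA I 9.4.9: a quasi-coherent module on a Noetherian scheme is the union of its coherent
submodules). [cite: Hartshorne1977, II Ex. 5.15 (e) (p. 126)] -/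
theorem exists_coh_mono_app_eq [IsNoetherian X] [X.IsSeparated] {M : X.Modules}
    (hM : IsAffineLocalizing M) {κ : Type*} [Finite κ] (Wf : κ → X.Opens) (sf : ∀ k, Γ(M, Wf k)) :
    ∃ (M' : X.Modules) (ι : M' ⟶ M), Coh M' ∧ Mono ι ∧
      ∀ k, ∃ y : Γ(M', Wf k), ι.app (Wf k) y = sf k := by
  classical
  haveI := Fintype.ofFinite κ
  -- induction over finite sets of indices
  suffices h : ∀ S : Finset κ, ∃ (M' : X.Modules) (ι : M' ⟶ M), Coh M' ∧ Mono ι ∧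
      ∀ k ∈ S, ∃ y : Γ(M', Wf k), ι.app (Wf k) y = sf k by
    obtain ⟨M', ι, hc, hm, hy⟩ := h Finset.univ
    exact ⟨M', ι, hc, hm, fun k => hy k (Finset.mem_univ k)⟩
  intro S
  induction S using Finset.induction with
  | empty =>
    -- any coherent submodule: the image of a Deligne morphism for the zero section over `⊤`
    obtain ⟨n, φ, e, -⟩ := exists_hom_app_eq (W := ⊤) (0 : Γ(M, ⊤)) hM
    exact ⟨Abelian.image φ, Abelian.image.ι φ,
      coh_image_of_isAffineLocalizing φ (coh_powIdealModule ⊤ n) hM, inferInstance,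
      fun k hk => absurd hk (Finset.notMem_empty k)⟩
  | insert k₀ S hk₀ ih =>
    obtain ⟨M', ι, hc, hm, hy⟩ := ih
    obtain ⟨n, φ, e, he⟩ := exists_hom_app_eq (sf k₀) hM
    -- the image of `M' ⊞ 𝓘ⁿ𝒪_X ⟶ M`
    let g : M' ⊞ powIdealModule (Wf k₀) n ⟶ M := biprod.desc ι φ
    refine ⟨Abelian.image g, Abelian.image.ι g,
      coh_image_of_isAffineLocalizing g (coh_biprod_of_coh hc (coh_powIdealModule (Wf k₀) n)) hM,
      inferInstance, fun k hk => ?_⟩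
    rcases Finset.mem_insert.mp hk with rfl | hk
    · refine ⟨(biprod.inr ≫ Abelian.factorThruImage g).app (Wf k) e, ?_⟩
      rw [← comp_app_apply_aux, Category.assoc, Abelian.image.fac, biprod.inr_desc]
      exact he
    · obtain ⟨y, hy⟩ := hy k hk
      refine ⟨(biprod.inl ≫ Abelian.factorThruImage g).app (Wf k) y, ?_⟩
      rw [← comp_app_apply_aux, Category.assoc, Abelian.image.fac, biprod.inl_desc]
      exact hy

/-- **Every Čech `2`-cocycle of an affine-localizing module lies in a coherent submodule**
(consequence of Deligne's formula / EGA I 9.4.9 «a quasi-coherent module on a Noetherian scheme is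
the union of its coherent submodules»): for `X` Noetherian and separated, a FINITE family of affine
opens `U`, `M` affine-localizing and `z ∈ Ž²(𝒰, M)`, there are a coherent `M′`, a morphism
`φ : M′ ⟶ M` (a monomorphism) and a `2`-cocycle `z′` of `M′` on `𝒰` with `φ(z′) = z`.
[cite: Hartshorne1977, II Ex. 5.15 (e) (p. 126)] -/
theorem exists_coh_cechMZ2_map_eq {A : Type u} [CommRing A]
    (f : X ⟶ Spec (.of A)) [IsNoetherian X] [X.IsSeparated] {ι : Type v} [Finite ι]
    (U : ι → X.Opens) (hU : ∀ i, IsAffineOpen (U i)) {M : X.Modules} (hM : IsAffineLocalizing M)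
    (z : CechMC2 f M U) (hz : z ∈ cechMZ2 f M U) :
    ∃ (M' : X.Modules) (φ : M' ⟶ M) (z' : CechMC2 f M' U),
      Coh M' ∧ z' ∈ cechMZ2 f M' U ∧ cechMapC2 f φ U z' = z := by
  have _ := hU
  obtain ⟨M', φ, hc, hm, hy⟩ := exists_coh_mono_app_eq hM
    (fun σ : ι × ι × ι => U σ.1 ⊓ U σ.2.1 ⊓ U σ.2.2)
    (fun σ => (show Γ(M, U σ.1 ⊓ U σ.2.1 ⊓ U σ.2.2) from z σ.1 σ.2.1 σ.2.2))
  choose y hy using hy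
  let z' : CechMC2 f M' U := fun i j k => (show MSections f M' (U i ⊓ U j ⊓ U k) from y (i, j, k))
  have hz' : cechMapC2 f φ U z' = z := by
    funext i j k
    rw [cechMapC2_apply, MSections.app_apply]
    exact hy (i, j, k)
  refine ⟨M', φ, z', hc, ?_, hz'⟩
  -- `z'` is a cocycle because `φ` is injective on sections and `φ(d z') = d z = 0`
  rw [mem_cechMZ2_iff]
  have h3 : cechMapC3 f φ U (cechMD2 f M' U z') = 0 := by
    rw [← cechMD2_mapC2, hz']
    exact (mem_cechMZ2_iff f M U z).mp hz
  funext i j k l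
  have hinj : Function.Injective (φ.app (U i ⊓ U j ⊓ U k ⊓ U l)) := by
    haveI := hm
    exact (sections_exact_of_exact_of_mono
      (ShortComplex.exact_cokernel φ : (ShortComplex.mk φ (cokernel.π φ) (cokernel.condition φ)).Exact)
      (U i ⊓ U j ⊓ U k ⊓ U l)).1
  apply hinj
  have h4 := congrFun (congrFun (congrFun (congrFun h3 i) j) k) l
  rw [cechMapC3_apply, MSections.app_apply] at h4
  rw [h4]
  exact (map_zero (φ.app (U i ⊓ U j ⊓ U k ⊓ U l)).hom).symm

end Literature.AlgebraicGeometry.Morphisms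

end
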